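import Mathlib.Analysis.Complex.LocallyUniformLimit
import Mathlib.Analysis.Calculus.Taylor
import Summits.QuantumFields.BalabanUV.Beta.EriceFlowEnclosureBorelTransformSmooth

/-!
# Beta / EriceFlowEnclosureBorelTransformTaylor — THE BOREL TRANSFORM IS REAL-ANALYTIC WITH TAYLOR RADIUS `1∕K` AT EVERY `t₀ > 0`:
# its Taylor series `T_{t₀}(τ) = Σ_k J^{(k)}(t₀)(τ − t₀)^k∕k!` is HOLOMORPHIC on the disc `‖τ − t₀‖ < 1∕K`, SUMS TO `J` on
# `[t₀, t₀ + 1∕K[`, two such discs AGREE on their overlap, and `‖T_{t₀}(τ)‖ ≤ 2πC·L(t₀)·S(θ)` on `‖τ − t₀‖ ≤ θ∕K` with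
# `L(t₀) = 1 + Kt₀ + e^{ct₀}K²∕(2c²)` — the local model of Nevanlinna's continuation to the STRIP (36c's estimate
# `‖J^{(k)}(t)‖ ≤ 2πC·K^k k!·(k+1)(k+2)·L(t)` + Taylor's formula with the Lagrange bound)
# (bflow-p3 gen 39, exploratory MODULE 36d over 36c; Mathlib + tree only)

HONEST FRAMING (page 1 of everything the β sub-cell writes): discharging `BetaPertH` makes Bałaban's UV stability UNCONDITIONAL — a
real constructive-QFT result; it is NOT the continuum limit and NOT the Clay problem.  HONEST DEPENDENCY (cell reorg 2026-08-19,
verbatim): «continuum YM on T⁴ ⇐ BetaPertH ∧ nine spine estimates (0/9 proved); BetaPertH ⇐ (D1) ∧ (D4) ∧ CAP+tail; G-an2-4 gates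
asym, D1 and NE2/3/4.»  THIS MODULE DISCHARGES NOTHING: [folklore] one-variable analysis over Mathlib (no β-function, no flow, no
Erice sentence is used).

SOURCE (shapes only).  [Rivasseau1991] Thm I.5.1 pp. 55–56 (B admits an analytic continuation in the strip S_σ = {t | dist(t, ℝ⁺) < 1∕σ} — our condensation);
[LodayRichaud2016] Thm 5.3.9 (ii)⇒(i) pp. 158–163.

WHAT THIS FILE PROVES (0 sorry, 0 def).  §1 `summable_taylor_majorant`.  §2 `summable_taylor`, **`differentiableOn_taylor`** (holomorphy on `ball t₀ K⁻¹`), `norm_taylor_le`.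
§3 **`hasSum_taylor_real`** (`J t = T_{t₀}(t)` for `t₀ ≤ t`, `K(t − t₀) < 1`).  §4 **`taylor_agree`** (two discs agree on their overlap,
`|t₁ − t₀| < 1∕K`; identity theorem from the real segment above `max t₀ t₁`).
-/

namespace Summit.QuantumFields.BalabanUV.Beta.EriceFlowEnclosureBorelTransformTaylor

open Set Filter Topology MeasureTheory Metric Complex
open scoped Real Nat
open Summit.QuantumFields.BalabanUV.Beta.EriceFlowEnclosureBorelTransformSmooth

noncomputable section

/-! ## §1 The summable majorant (the compact derivative bound `‖J^{(k)}‖ ≤ 2πC·K^k k!·(k+1)(k+2)·L` is 36c's) -/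

/-- The majorant `(6k² + 2)·θ^k` is summable for `0 ≤ θ < 1`. [folklore] -/
theorem summable_taylor_majorant {θ : ℝ} (hθ0 : 0 ≤ θ) (hθ : θ < 1) :
    Summable fun k : ℕ => (6 * (k : ℝ) ^ 2 + 2) * θ ^ k := by
  have h1 := summable_pow_mul_geometric_of_norm_lt_one 2 (by rwa [Real.norm_of_nonneg hθ0] : ‖θ‖ < 1)
  have h2 := summable_geometric_of_lt_one hθ0 hθ
  exact ((h1.mul_left 6).add (h2.mul_left 2)).congr fun k => by ring

/-! ## §2 The Taylor series at `t₀ > 0`: summability, holomorphy on the disc `‖τ − t₀‖ < 1∕K`, size -/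

/-- **Termwise bound of the Taylor series**: for `‖τ − t₀‖ ≤ θ∕K`,
`‖J^{(k)}(t₀)·(τ − t₀)^k∕k!‖ ≤ 2πC·L(t₀)·(6k² + 2)·θ^k`. [folklore] -/
theorem norm_taylor_term_le {G : ℂ → ℂ} {a : ℕ → ℂ} {c₀ c C K : ℝ} (hc₀ : 0 < c₀) (hc : c₀ < c)
    (hC : 0 ≤ C) (hK : 0 < K) (hG : DifferentiableOn ℂ G {w : ℂ | c₀ < w.re})
    (hrem : ∀ N : ℕ, 1 ≤ N → ∀ w : ℂ, c₀ < w.re →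
      ‖G w - ∑ n ∈ Finset.Ico 1 N, a n * (1 / w ^ (n + 1))‖ ≤ C * K ^ N * N ! / ‖w‖ ^ (N + 1))
    (ha : ∀ n : ℕ, ‖a n‖ ≤ C * K ^ n * n !) {t₀ θ : ℝ} (ht₀ : 0 < t₀) (hθ0 : 0 ≤ θ) {τ : ℂ} (hτ : ‖τ - t₀‖ ≤ θ / K)
    (k : ℕ) :
    ‖iteratedDeriv k (fun t : ℝ => ∫ s : ℝ, cexp ((t : ℂ) * ((c : ℂ) + (s : ℂ) * I)) * G ((c : ℂ) + (s : ℂ) * I)) t₀ *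
        ((τ - t₀) ^ k / (k ! : ℂ))‖ ≤
      2 * π * C * (1 + K * t₀ + Real.exp (c * t₀) * K ^ 2 / (2 * c ^ 2)) * ((6 * (k : ℝ) ^ 2 + 2) * θ ^ k) := by
  have hd := norm_iteratedDeriv_lineTransform_le' hc₀ hc hC hK.le hG hrem ha k ht₀
  set L : ℝ := 1 + K * t₀ + Real.exp (c * t₀) * K ^ 2 / (2 * c ^ 2) with hL
  have hL0 : 0 ≤ L := by rw [hL]; positivity
  have hkf : (0 : ℝ) < k ! := by exact_mod_cast Nat.factorial_pos k
  rw [norm_mul, norm_div, norm_pow, Complex.norm_natCast]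
  have hτk : ‖τ - t₀‖ ^ k ≤ (θ / K) ^ k := pow_le_pow_left₀ (norm_nonneg _) hτ k
  calc ‖iteratedDeriv k (fun t : ℝ => ∫ s : ℝ, cexp ((t : ℂ) * ((c : ℂ) + (s : ℂ) * I)) * G ((c : ℂ) + (s : ℂ) * I)) t₀‖ *
        (‖τ - ↑t₀‖ ^ k / (k ! : ℝ))
      ≤ (2 * π * C * (K ^ k * k !) * (((k : ℝ) + 1) * ((k : ℝ) + 2)) * L) * ((θ / K) ^ k / (k ! : ℝ)) := by
        gcongr
    _ = 2 * π * C * L * ((((k : ℝ) + 1) * ((k : ℝ) + 2)) * θ ^ k) := by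
        rw [div_pow]
        field_simp
    _ ≤ 2 * π * C * L * ((6 * (k : ℝ) ^ 2 + 2) * θ ^ k) := by
        gcongr
        exact poly_le k

/-- **The Taylor series converges absolutely on the disc `‖τ − t₀‖ < 1∕K`.** [folklore] -/
theorem summable_taylor {G : ℂ → ℂ} {a : ℕ → ℂ} {c₀ c C K : ℝ} (hc₀ : 0 < c₀) (hc : c₀ < c)
    (hC : 0 ≤ C) (hK : 0 < K) (hG : DifferentiableOn ℂ G {w : ℂ | c₀ < w.re})
    (hrem : ∀ N : ℕ, 1 ≤ N → ∀ w : ℂ, c₀ < w.re →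
      ‖G w - ∑ n ∈ Finset.Ico 1 N, a n * (1 / w ^ (n + 1))‖ ≤ C * K ^ N * N ! / ‖w‖ ^ (N + 1))
    (ha : ∀ n : ℕ, ‖a n‖ ≤ C * K ^ n * n !) {t₀ : ℝ} (ht₀ : 0 < t₀) {τ : ℂ} (hτ : ‖τ - t₀‖ < K⁻¹) :
    Summable fun k : ℕ =>
      ‖iteratedDeriv k (fun t : ℝ => ∫ s : ℝ, cexp ((t : ℂ) * ((c : ℂ) + (s : ℂ) * I)) * G ((c : ℂ) + (s : ℂ) * I)) t₀ *
        ((τ - t₀) ^ k / (k ! : ℂ))‖ := by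
  set θ : ℝ := K * ‖τ - t₀‖ with hθ
  have hθ0 : 0 ≤ θ := by positivity
  have hθ1 : θ < 1 := by
    calc θ = K * ‖τ - t₀‖ := rfl
      _ < K * K⁻¹ := mul_lt_mul_of_pos_left hτ hK
      _ = 1 := mul_inv_cancel₀ hK.ne'
  have hτ' : ‖τ - t₀‖ ≤ θ / K := by rw [hθ, mul_div_assoc, mul_div_cancel₀ _ hK.ne']
  refine Summable.of_nonneg_of_le (fun k => norm_nonneg _)
    (fun k => norm_taylor_term_le hc₀ hc hC hK hG hrem ha ht₀ hθ0 hτ' k) ?_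
  exact (summable_taylor_majorant hθ0 hθ1).mul_left _

/-- **THE TAYLOR SERIES IS HOLOMORPHIC ON THE DISC `‖τ − t₀‖ < 1∕K`** (uniform majorants on every smaller disc; Mathlib
`Complex.differentiableOn_tsum_of_summable_norm`). [folklore] -/
theorem differentiableOn_taylor {G : ℂ → ℂ} {a : ℕ → ℂ} {c₀ c C K : ℝ} (hc₀ : 0 < c₀) (hc : c₀ < c)
    (hC : 0 ≤ C) (hK : 0 < K) (hG : DifferentiableOn ℂ G {w : ℂ | c₀ < w.re})
    (hrem : ∀ N : ℕ, 1 ≤ N → ∀ w : ℂ, c₀ < w.re →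
      ‖G w - ∑ n ∈ Finset.Ico 1 N, a n * (1 / w ^ (n + 1))‖ ≤ C * K ^ N * N ! / ‖w‖ ^ (N + 1))
    (ha : ∀ n : ℕ, ‖a n‖ ≤ C * K ^ n * n !) {t₀ : ℝ} (ht₀ : 0 < t₀) :
    DifferentiableOn ℂ (fun τ : ℂ => ∑' k : ℕ,
      iteratedDeriv k (fun t : ℝ => ∫ s : ℝ, cexp ((t : ℂ) * ((c : ℂ) + (s : ℂ) * I)) * G ((c : ℂ) + (s : ℂ) * I)) t₀ *
        ((τ - t₀) ^ k / (k ! : ℂ))) (ball ((t₀ : ℂ)) K⁻¹) := by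
  intro τ hτ
  rw [mem_ball, dist_eq_norm] at hτ
  -- a smaller closed radius `ρ' = (‖τ − t₀‖ + K⁻¹)∕2`
  set ρ' : ℝ := (‖τ - t₀‖ + K⁻¹) / 2 with hρ'
  have hρ'lt : ρ' < K⁻¹ := by rw [hρ']; linarith
  have hτρ' : ‖τ - t₀‖ < ρ' := by rw [hρ']; linarith
  set θ : ℝ := K * ρ' with hθ
  have hθ0 : 0 ≤ θ := by positivity
  have hθ1 : θ < 1 := by
    calc θ = K * ρ' := rfl
      _ < K * K⁻¹ := mul_lt_mul_of_pos_left hρ'lt hK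
      _ = 1 := mul_inv_cancel₀ hK.ne'
  set L : ℝ := 1 + K * t₀ + Real.exp (c * t₀) * K ^ 2 / (2 * c ^ 2) with hL
  have hd : DifferentiableOn ℂ (fun τ : ℂ => ∑' k : ℕ,
      iteratedDeriv k (fun t : ℝ => ∫ s : ℝ, cexp ((t : ℂ) * ((c : ℂ) + (s : ℂ) * I)) * G ((c : ℂ) + (s : ℂ) * I)) t₀ *
        ((τ - t₀) ^ k / (k ! : ℂ))) (ball ((t₀ : ℂ)) ρ') := by
    refine Complex.differentiableOn_tsum_of_summable_norm (u := fun k : ℕ => 2 * π * C * L * ((6 * (k : ℝ) ^ 2 + 2) * θ ^ k))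
      ((summable_taylor_majorant hθ0 hθ1).mul_left _)
      (fun k => (differentiableOn_const _).mul (((differentiableOn_id.sub_const _).pow k).div_const _)) isOpen_ball
      fun k w hw => ?_
    rw [mem_ball, dist_eq_norm] at hw
    have hw' : ‖w - t₀‖ ≤ θ / K := by
      rw [hθ, mul_div_assoc, mul_div_cancel₀ _ hK.ne']; exact hw.le
    exact norm_taylor_term_le hc₀ hc hC hK hG hrem ha ht₀ hθ0 hw' k
  exact (hd.differentiableAt (isOpen_ball.mem_nhds (by rw [mem_ball, dist_eq_norm]; exact hτρ'))).differentiableWithinAt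

/-- **Size of the Taylor series on the closed disc `‖τ − t₀‖ ≤ θ∕K`** (`0 ≤ θ < 1`):
`‖T_{t₀}(τ)‖ ≤ 2πC·L(t₀)·Σ_k (6k²+2)θ^k`. [folklore] -/
theorem norm_taylor_le {G : ℂ → ℂ} {a : ℕ → ℂ} {c₀ c C K : ℝ} (hc₀ : 0 < c₀) (hc : c₀ < c)
    (hC : 0 ≤ C) (hK : 0 < K) (hG : DifferentiableOn ℂ G {w : ℂ | c₀ < w.re})
    (hrem : ∀ N : ℕ, 1 ≤ N → ∀ w : ℂ, c₀ < w.re →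
      ‖G w - ∑ n ∈ Finset.Ico 1 N, a n * (1 / w ^ (n + 1))‖ ≤ C * K ^ N * N ! / ‖w‖ ^ (N + 1))
    (ha : ∀ n : ℕ, ‖a n‖ ≤ C * K ^ n * n !) {t₀ θ : ℝ} (ht₀ : 0 < t₀) (hθ0 : 0 ≤ θ) (hθ1 : θ < 1)
    {τ : ℂ} (hτ : ‖τ - t₀‖ ≤ θ / K) :
    ‖∑' k : ℕ, iteratedDeriv k (fun t : ℝ => ∫ s : ℝ, cexp ((t : ℂ) * ((c : ℂ) + (s : ℂ) * I)) * G ((c : ℂ) + (s : ℂ) * I)) t₀ *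
        ((τ - t₀) ^ k / (k ! : ℂ))‖ ≤
      2 * π * C * (1 + K * t₀ + Real.exp (c * t₀) * K ^ 2 / (2 * c ^ 2)) * ∑' k : ℕ, (6 * (k : ℝ) ^ 2 + 2) * θ ^ k := by
  have hmaj := summable_taylor_majorant hθ0 hθ1
  have hterm := fun k => norm_taylor_term_le hc₀ hc hC hK hG hrem ha ht₀ hθ0 hτ k
  have hsn : Summable fun k : ℕ =>
      ‖iteratedDeriv k (fun t : ℝ => ∫ s : ℝ, cexp ((t : ℂ) * ((c : ℂ) + (s : ℂ) * I)) * G ((c : ℂ) + (s : ℂ) * I)) t₀ *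
        ((τ - t₀) ^ k / (k ! : ℂ))‖ :=
    Summable.of_nonneg_of_le (fun k => norm_nonneg _) hterm (hmaj.mul_left _)
  calc _ ≤ ∑' k : ℕ, ‖iteratedDeriv k (fun t : ℝ => ∫ s : ℝ, cexp ((t : ℂ) * ((c : ℂ) + (s : ℂ) * I)) *
        G ((c : ℂ) + (s : ℂ) * I)) t₀ * ((τ - t₀) ^ k / (k ! : ℂ))‖ := norm_tsum_le_tsum_norm hsn
    _ ≤ ∑' k : ℕ, 2 * π * C * (1 + K * t₀ + Real.exp (c * t₀) * K ^ 2 / (2 * c ^ 2)) * ((6 * (k : ℝ) ^ 2 + 2) * θ ^ k) :=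
        hsn.tsum_le_tsum hterm (hmaj.mul_left _)
    _ = _ := tsum_mul_left

/-! ## §3 Taylor's formula: the series sums to `J` on `[t₀, t₀ + 1∕K[` -/

/-- **THE TAYLOR SERIES SUMS TO THE BOREL TRANSFORM on `[t₀, t₀ + 1∕K[`** (Taylor's formula on `[t₀, t]` with the Lagrange bound,
Mathlib `taylor_mean_remainder_bound`; the remainder is `≤ 2πC·L(t)·(n+1)(n+2)(n+3)·(K(t − t₀))^{n+1} → 0`). [folklore] -/
theorem hasSum_taylor_real {G : ℂ → ℂ} {a : ℕ → ℂ} {c₀ c C K : ℝ} (hc₀ : 0 < c₀) (hc : c₀ < c)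
    (hC : 0 ≤ C) (hK : 0 < K) (hG : DifferentiableOn ℂ G {w : ℂ | c₀ < w.re})
    (hrem : ∀ N : ℕ, 1 ≤ N → ∀ w : ℂ, c₀ < w.re →
      ‖G w - ∑ n ∈ Finset.Ico 1 N, a n * (1 / w ^ (n + 1))‖ ≤ C * K ^ N * N ! / ‖w‖ ^ (N + 1))
    (ha : ∀ n : ℕ, ‖a n‖ ≤ C * K ^ n * n !) {t₀ t : ℝ} (ht₀ : 0 < t₀) (ht₀t : t₀ ≤ t) (hKt : K * (t - t₀) < 1) :
    HasSum (fun k : ℕ =>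
      iteratedDeriv k (fun t : ℝ => ∫ s : ℝ, cexp ((t : ℂ) * ((c : ℂ) + (s : ℂ) * I)) * G ((c : ℂ) + (s : ℂ) * I)) t₀ *
        (((t : ℂ) - t₀) ^ k / (k ! : ℂ)))
      (∫ s : ℝ, cexp ((t : ℂ) * ((c : ℂ) + (s : ℂ) * I)) * G ((c : ℂ) + (s : ℂ) * I)) := by
  set J : ℝ → ℂ := fun t : ℝ => ∫ s : ℝ, cexp ((t : ℂ) * ((c : ℂ) + (s : ℂ) * I)) * G ((c : ℂ) + (s : ℂ) * I) with hJ
  have hcpos : 0 < c := hc₀.trans hc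
  set g : ℕ → ℂ := fun k : ℕ => iteratedDeriv k J t₀ * (((t : ℂ) - t₀) ^ k / (k ! : ℂ)) with hg
  -- the degenerate case `t = t₀`
  rcases eq_or_lt_of_le ht₀t with heq | hlt
  · subst heq
    have h0 : ∀ k : ℕ, k ≠ 0 → g k = 0 := fun k hk => by
      simp only [hg, sub_self, zero_pow hk, zero_div, mul_zero]
    have := hasSum_single (f := g) 0 (fun k hk => h0 k hk)
    simpa [hg] using this
  -- absolute convergence
  have hnorm : ‖((t : ℂ)) - t₀‖ < K⁻¹ := by
    rw [← Complex.ofReal_sub, Complex.norm_real, Real.norm_of_nonneg (by linarith)]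
    rw [lt_inv_comm₀ (by linarith) hK]
    calc K = K * (t - t₀) / (t - t₀) := by field_simp
      _ < 1 / (t - t₀) := by gcongr
      _ = (t - t₀)⁻¹ := one_div _
  have hsumm : Summable g := (summable_taylor hc₀ hc hC hK hG hrem ha ht₀ hnorm).of_norm
  -- smoothness on `[t₀, t]`
  have hcd : ∀ (m : ℕ), ∀ y ∈ Icc t₀ t, ContDiffAt ℝ m J y := fun m y hy =>
    contDiffAt_lineTransform hc₀ hc hC hK.le hG hrem m (ht₀.trans_le hy.1)
  have hU : UniqueDiffOn ℝ (Icc t₀ t) := uniqueDiffOn_Icc hlt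
  -- the partial sums are the Taylor polynomials
  have hpartial : ∀ n : ℕ, ∑ k ∈ Finset.range (n + 1), g k = taylorWithinEval J n (Icc t₀ t) t₀ t := by
    intro n
    rw [taylor_within_apply]
    refine Finset.sum_congr rfl fun k _ => ?_
    rw [iteratedDerivWithin_eq_iteratedDeriv hU (hcd k t₀ (left_mem_Icc.mpr ht₀t)) (left_mem_Icc.mpr ht₀t),
      Complex.real_smul, hg]
    push_cast
    ring
  -- the remainder
  set θ : ℝ := K * (t - t₀) with hθ
  have hθ0 : 0 ≤ θ := by rw [hθ]; exact mul_nonneg hK.le (by linarith)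
  have htpos : 0 < t := ht₀.trans_le ht₀t
  set L : ℝ := 1 + K * t + Real.exp (c * t) * K ^ 2 / (2 * c ^ 2) with hL
  have hL0 : 0 ≤ L := by rw [hL]; positivity
  have hrem_n : ∀ n : ℕ, ‖J t - ∑ k ∈ Finset.range (n + 1), g k‖ ≤
      2 * π * C * L * ((((n : ℝ) + 1) * ((n : ℝ) + 2) * ((n : ℝ) + 3)) * θ ^ (n + 1)) := by
    intro n
    rw [hpartial n]
    set Cn : ℝ := 2 * π * C * (K ^ (n + 1) * (n + 1)!) * ((((n + 1 : ℕ) : ℝ) + 1) * (((n + 1 : ℕ) : ℝ) + 2)) * L with hCn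
    have hbound : ∀ y ∈ Icc t₀ t, ‖iteratedDerivWithin (n + 1) J (Icc t₀ t) y‖ ≤ Cn := by
      intro y hy
      have hy0 : 0 < y := ht₀.trans_le hy.1
      rw [iteratedDerivWithin_eq_iteratedDeriv hU (hcd (n + 1) y hy) hy]
      refine (norm_iteratedDeriv_lineTransform_le' hc₀ hc hC hK.le hG hrem ha (n + 1) hy0).trans ?_
      rw [hCn]
      have hLy : 1 + K * y + Real.exp (c * y) * K ^ 2 / (2 * c ^ 2) ≤ L := by
        rw [hL]
        have h1 : K * y ≤ K * t := mul_le_mul_of_nonneg_left hy.2 hK.le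
        have h2 : Real.exp (c * y) ≤ Real.exp (c * t) := Real.exp_le_exp.mpr (mul_le_mul_of_nonneg_left hy.2 hcpos.le)
        have h3 : Real.exp (c * y) * K ^ 2 / (2 * c ^ 2) ≤ Real.exp (c * t) * K ^ 2 / (2 * c ^ 2) := by
          gcongr
        linarith
      gcongr
    have hT := taylor_mean_remainder_bound (f := J) (n := n) ht₀t
      (fun y hy => (hcd (n + 1) y hy).contDiffWithinAt) (right_mem_Icc.mpr ht₀t) hbound
    refine hT.trans (le_of_eq ?_)
    have hnf : (n ! : ℝ) ≠ 0 := by exact_mod_cast Nat.factorial_ne_zero n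
    have hfac : ((n + 1) ! : ℝ) = ((n : ℝ) + 1) * n ! := by push_cast [Nat.factorial_succ]; ring
    rw [hCn, hfac, hθ, mul_pow]
    push_cast
    field_simp
    ring
  -- the remainder tends to `0`
  have hθ1 : θ < 1 := hKt
  have hlim : Tendsto (fun n : ℕ => 2 * π * C * L * ((((n : ℝ) + 1) * ((n : ℝ) + 2) * ((n : ℝ) + 3)) * θ ^ (n + 1)))
      atTop (𝓝 0) := by
    -- `(n+1)(n+2)(n+3) θ^{n+1} ≤ 24·(n+1)^3·θ^{n+1}` and `m^3 θ^m → 0`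
    have h3 := tendsto_pow_const_mul_const_pow_of_lt_one 3 hθ0 hθ1
    have h3' : Tendsto (fun n : ℕ => (((n + 1 : ℕ) : ℝ)) ^ 3 * θ ^ (n + 1)) atTop (𝓝 0) :=
      h3.comp (tendsto_add_atTop_nat 1)
    have hmaj : Tendsto (fun n : ℕ => 2 * π * C * L * (6 * ((((n + 1 : ℕ) : ℝ)) ^ 3 * θ ^ (n + 1)))) atTop (𝓝 0) := by
      simpa using (h3'.const_mul 6).const_mul (2 * π * C * L)
    refine squeeze_zero (fun n => by positivity) (fun n => ?_) hmaj
    have hpoly : ((n : ℝ) + 1) * ((n : ℝ) + 2) * ((n : ℝ) + 3) ≤ 6 * (((n + 1 : ℕ) : ℝ)) ^ 3 := by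
      have hn : (0 : ℝ) ≤ n := Nat.cast_nonneg n
      push_cast; nlinarith [sq_nonneg ((n : ℝ) + 1), hn, mul_nonneg hn hn, mul_nonneg (mul_nonneg hn hn) hn]
    have hθn : 0 ≤ θ ^ (n + 1) := pow_nonneg hθ0 _
    calc 2 * π * C * L * (((n : ℝ) + 1) * ((n : ℝ) + 2) * ((n : ℝ) + 3) * θ ^ (n + 1))
        ≤ 2 * π * C * L * (6 * (((n + 1 : ℕ) : ℝ)) ^ 3 * θ ^ (n + 1)) := by gcongr
      _ = 2 * π * C * L * (6 * ((((n + 1 : ℕ) : ℝ)) ^ 3 * θ ^ (n + 1))) := by ring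
  have htend : Tendsto (fun n : ℕ => ∑ k ∈ Finset.range (n + 1), g k) atTop (𝓝 (J t)) := by
    have hev : ∀ n : ℕ, ‖(∑ k ∈ Finset.range (n + 1), g k) - J t‖ ≤
        2 * π * C * L * ((((n : ℝ) + 1) * ((n : ℝ) + 2) * ((n : ℝ) + 3)) * θ ^ (n + 1)) := fun n => by
      rw [norm_sub_rev]; exact hrem_n n
    have := squeeze_zero_norm hev hlim
    rw [tendsto_sub_nhds_zero_iff] at this
    exact this
  -- compare with the sum of the series
  have h1 : Tendsto (fun n : ℕ => ∑ k ∈ Finset.range (n + 1), g k) atTop (𝓝 (∑' k, g k)) :=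
    (hsumm.hasSum.tendsto_sum_nat).comp (tendsto_add_atTop_nat 1)
  have huniq := tendsto_nhds_unique h1 htend
  change HasSum g (J t)
  rw [← huniq]
  exact hsumm.hasSum

/-! ## §4 Two Taylor discs agree on their overlap -/

/-- **Two Taylor discs agree on their overlap**: for `t₀, t₁ > 0` with `|t₁ − t₀| < 1∕K`, `T_{t₀} = T_{t₁}` on
`ball t₀ K⁻¹ ∩ ball t₁ K⁻¹` (both are holomorphic there and equal `J` on the real segment just above `max t₀ t₁`; identity theorem in
Mathlib's «frequently equal» form on the convex intersection). [folklore] -/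
theorem taylor_agree {G : ℂ → ℂ} {a : ℕ → ℂ} {c₀ c C K : ℝ} (hc₀ : 0 < c₀) (hc : c₀ < c)
    (hC : 0 ≤ C) (hK : 0 < K) (hG : DifferentiableOn ℂ G {w : ℂ | c₀ < w.re})
    (hrem : ∀ N : ℕ, 1 ≤ N → ∀ w : ℂ, c₀ < w.re →
      ‖G w - ∑ n ∈ Finset.Ico 1 N, a n * (1 / w ^ (n + 1))‖ ≤ C * K ^ N * N ! / ‖w‖ ^ (N + 1))
    (ha : ∀ n : ℕ, ‖a n‖ ≤ C * K ^ n * n !) {t₀ t₁ : ℝ} (ht₀ : 0 < t₀) (ht₁ : 0 < t₁) (hclose : |t₁ - t₀| < K⁻¹) :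
    EqOn
      (fun τ : ℂ => ∑' k : ℕ,
        iteratedDeriv k (fun t : ℝ => ∫ s : ℝ, cexp ((t : ℂ) * ((c : ℂ) + (s : ℂ) * I)) * G ((c : ℂ) + (s : ℂ) * I)) t₀ *
          ((τ - t₀) ^ k / (k ! : ℂ)))
      (fun τ : ℂ => ∑' k : ℕ,
        iteratedDeriv k (fun t : ℝ => ∫ s : ℝ, cexp ((t : ℂ) * ((c : ℂ) + (s : ℂ) * I)) * G ((c : ℂ) + (s : ℂ) * I)) t₁ *
          ((τ - t₁) ^ k / (k ! : ℂ)))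
      (ball ((t₀ : ℂ)) K⁻¹ ∩ ball ((t₁ : ℂ)) K⁻¹) := by
  set U : Set ℂ := ball ((t₀ : ℂ)) K⁻¹ ∩ ball ((t₁ : ℂ)) K⁻¹ with hU
  have hUo : IsOpen U := isOpen_ball.inter isOpen_ball
  have hUc : IsPreconnected U := ((convex_ball _ _).inter (convex_ball _ _)).isPreconnected
  have hKi : 0 < K⁻¹ := inv_pos.mpr hK
  -- the base point `m = max t₀ t₁`
  set m : ℝ := max t₀ t₁ with hm
  have hm0 : t₀ ≤ m := le_max_left _ _
  have hm1 : t₁ ≤ m := le_max_right _ _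
  have hmt₀ : m - t₀ < K⁻¹ := by
    rcases le_total t₀ t₁ with h | h
    · rw [hm, max_eq_right h]; exact (le_abs_self _).trans_lt hclose
    · rw [hm, max_eq_left h, sub_self]; exact hKi
  have hmt₁ : m - t₁ < K⁻¹ := by
    rcases le_total t₀ t₁ with h | h
    · rw [hm, max_eq_right h, sub_self]; exact hKi
    · rw [hm, max_eq_left h]; rw [abs_sub_comm] at hclose; exact (le_abs_self _).trans_lt hclose
  have hmU : ((m : ℂ)) ∈ U := by
    refine ⟨?_, ?_⟩ <;> rw [mem_ball, dist_eq_norm, ← Complex.ofReal_sub, Complex.norm_real, Real.norm_of_nonneg (by linarith)]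
    · exact hmt₀
    · exact hmt₁
  -- holomorphy of both series on `U`
  have hA₀ := (differentiableOn_taylor hc₀ hc hC hK hG hrem ha ht₀).mono (inter_subset_left (s := ball ((t₀ : ℂ)) K⁻¹)
    (t := ball ((t₁ : ℂ)) K⁻¹))
  have hA₁ := (differentiableOn_taylor hc₀ hc hC hK hG hrem ha ht₁).mono (inter_subset_right (s := ball ((t₀ : ℂ)) K⁻¹)
    (t := ball ((t₁ : ℂ)) K⁻¹))
  -- agreement on the real segment `]m, m + ε[`
  set ε : ℝ := min (K⁻¹ - (m - t₀)) (K⁻¹ - (m - t₁)) with hε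
  have hεpos : 0 < ε := lt_min (by linarith) (by linarith)
  have hreal : ∀ x : ℝ, m < x → x < m + ε →
      (∑' k : ℕ, iteratedDeriv k (fun t : ℝ => ∫ s : ℝ, cexp ((t : ℂ) * ((c : ℂ) + (s : ℂ) * I)) *
          G ((c : ℂ) + (s : ℂ) * I)) t₀ * ((((x : ℂ)) - t₀) ^ k / (k ! : ℂ))) =
      ∑' k : ℕ, iteratedDeriv k (fun t : ℝ => ∫ s : ℝ, cexp ((t : ℂ) * ((c : ℂ) + (s : ℂ) * I)) *
          G ((c : ℂ) + (s : ℂ) * I)) t₁ * ((((x : ℂ)) - t₁) ^ k / (k ! : ℂ)) := by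
    intro x hx1 hx2
    have hε0 : ε ≤ K⁻¹ - (m - t₀) := min_le_left _ _
    have hε1 : ε ≤ K⁻¹ - (m - t₁) := min_le_right _ _
    have hK0 : K * (x - t₀) < 1 := by
      have : x - t₀ < K⁻¹ := by linarith
      calc K * (x - t₀) < K * K⁻¹ := mul_lt_mul_of_pos_left this hK
        _ = 1 := mul_inv_cancel₀ hK.ne'
    have hK1 : K * (x - t₁) < 1 := by
      have : x - t₁ < K⁻¹ := by linarith
      calc K * (x - t₁) < K * K⁻¹ := mul_lt_mul_of_pos_left this hK
        _ = 1 := mul_inv_cancel₀ hK.ne'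
    have h0 := hasSum_taylor_real hc₀ hc hC hK hG hrem ha ht₀ (by linarith) hK0
    have h1 := hasSum_taylor_real hc₀ hc hC hK hG hrem ha ht₁ (by linarith) hK1
    rw [h0.tsum_eq, h1.tsum_eq]
  -- push to a «frequently» statement at `m` in `ℂ`
  have hev : ∀ᶠ x : ℝ in 𝓝[>] m, (fun τ : ℂ => ∑' k : ℕ,
        iteratedDeriv k (fun t : ℝ => ∫ s : ℝ, cexp ((t : ℂ) * ((c : ℂ) + (s : ℂ) * I)) * G ((c : ℂ) + (s : ℂ) * I)) t₀ *
          ((τ - t₀) ^ k / (k ! : ℂ))) (x : ℂ) =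
      (fun τ : ℂ => ∑' k : ℕ,
        iteratedDeriv k (fun t : ℝ => ∫ s : ℝ, cexp ((t : ℂ) * ((c : ℂ) + (s : ℂ) * I)) * G ((c : ℂ) + (s : ℂ) * I)) t₁ *
          ((τ - t₁) ^ k / (k ! : ℂ))) (x : ℂ) := by
    have hIoo : Ioo m (m + ε) ∈ 𝓝[>] m := Ioo_mem_nhdsGT (by linarith)
    filter_upwards [hIoo] with x hx using hreal x hx.1 hx.2
  have htend : Tendsto (fun x : ℝ => ((x : ℂ))) (𝓝[>] m) (𝓝[≠] ((m : ℂ))) :=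
    Complex.continuous_ofReal.continuousWithinAt.tendsto_nhdsWithin fun x hx => by
      simp only [mem_compl_iff, mem_singleton_iff, Complex.ofReal_inj]; exact ne_of_gt hx
  have hfreq : ∃ᶠ z in 𝓝[≠] ((m : ℂ)),
      (fun τ : ℂ => ∑' k : ℕ,
        iteratedDeriv k (fun t : ℝ => ∫ s : ℝ, cexp ((t : ℂ) * ((c : ℂ) + (s : ℂ) * I)) * G ((c : ℂ) + (s : ℂ) * I)) t₀ *
          ((τ - t₀) ^ k / (k ! : ℂ))) z =
      (fun τ : ℂ => ∑' k : ℕ,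
        iteratedDeriv k (fun t : ℝ => ∫ s : ℝ, cexp ((t : ℂ) * ((c : ℂ) + (s : ℂ) * I)) * G ((c : ℂ) + (s : ℂ) * I)) t₁ *
          ((τ - t₁) ^ k / (k ! : ℂ))) z :=
    (hev.frequently.filter_mono le_rfl |> fun h => (Filter.frequently_map.mpr h)).filter_mono htend
  exact (hA₀.analyticOnNhd hUo).eqOn_of_preconnected_of_frequently_eq (hA₁.analyticOnNhd hUo) hUc hmU hfreq

end

end Summit.QuantumFields.BalabanUV.Beta.EriceFlowEnclosureBorelTransformTaylor
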